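import Summits.BirchSwinnertonDyer.Rank1Residual.WAll.Target
import HarnessLib
import HarnessLib.Audit.Tags

/-!
# Rung W-ALL of ladder BSD (D-0120) — row 1 (`NonCMAtTwo`, non-CM at `p = 2`) SLICED along the
# THETA HABITAT of route `ThetaPartnerAtTwo`: «rank `0` ∧ good supersingular at `2` ∧ `a₂ = 0` ∧ a
# rank-`0` CM partner `A` with `A[2] ≅ E[2]`» / its complement (the route's residual item, verbatim)
# (cell `bsd-wall`, lane (2), seat `bsd-wall-ty-1`; new small file importing `WAll.Target` only)

HONEST FRAMING (cell `bsd-wall`, run/shared/lean/pub/bsd-wall/; brief `WALL-BRIEF-v1.md` sha16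
b966bf16da27706e §2): STATEMENTS AND BOOKKEEPING ONLY — nothing asserted, nothing booked, no named
fact, no published theorem restated; the two `@[conjecture] def`s below are OPEN obligations and
SLICES of the registered row-1 leaf `Summit.BirchSwinnertonDyer.BirchSwinnertonDyer.Rank1Residual.NonCMAtTwo`
(`Theorems/Rank1ResidualX5TwoDefs.lean`, rung K4; reused as row 1 of `WAll/Target.lean`: non-CM,
`r ≤ 1` ⇒ `BSD(E,2)`; in-table wall after RESISO at `p = 2`: `4 263` X5 classes, WALL-TABLE v1.12).

WHY THESE SLICES. The lane-3 route `route-BirchSwinnertonDyer-ThetaPartnerAtTwo` (OPEN, statements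
frozen at rev 7 0685c8cef1f0, READY YES 4/4; planner seat `bsd-wall-p2` ended 2026-08-27T08:47Z;
`--closes-target …Rank1Residual.NonCMAtTwo`, the whole row) attacks ONE sub-cell of row 1 — the
THETA HABITAT: `E` non-CM of analytic rank `0`, good supersingular at `2` with `a₂(E) = 0`, and
`2`-congruent (`E[2] ≅ A[2]` as `Γ_ℚ`-modules) to a CM curve `A/ℚ` of analytic rank `0`, good
supersingular at `2`, `a₂(A) = 0` (`19` of the `208` X5-supersingular rank-`0` classes of record,
N < 5·10⁵, HOME `bsd-wall-p2/` HABITAT-CENSUS-TP2 v1.1 8f55ee00: all `19` have a RANK-`0` CM partner) —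
and carries the rest of the row as ONE residual route item `OffThetaHabitatAtTwo`
(stmt-BirchSwinnertonDyer-20334, difficulty XL: it contains `BSD₂` for every non-CM rank-`1` curve and
every additive-at-`2` curve; the territory of `route-BirchSwinnertonDyer-ByReductionTypeAtTwo`). This
file puts that cut on the W-ALL books VERBATIM in the route's spelling, so that (i) the route may
`--closes-target` the habitat leaf BY NAME with no residual item of its own (its deciding theorem keeps
its habitat branch unchanged: `intro W _ _ hcm hr hss ha hA` replaces `intro W _ _ hcm hr1; by_cases hH;
obtain ⟨hr, hss, ha, A, …⟩ := hH`), (ii) item 20334 is a registered-shape leaf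
(`WAllNonCMAtTwoOffThetaHabitat`, so a prover closes either from the other by `exact`), and (iii) the
lane-2 closers of `WAll/AltClosersResidualCellsAtTwoR0Partner.lean` (ty-2 g5, p514468; hypotheses
`hHab` / `hOff` spelled exactly as the two leaves below) consume the leaves BY NAME.

| slice `Prop` (this file) | shape (all `∀ W [..] [..], ¬ W.HasCM → …`) | classes of record |
|---|---|---|
| `WAllNonCMAtTwoThetaHabitat` | `… → r = 0 → GoodSS W 2 → a₂ = 0 → (∃ rank-0 CM ss partner A, a₂(A) = 0, E[2] ≅ A[2]) → BSDp W 2` (= `hHab` of ty-2's closer) | `19` |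
| `WAllNonCMAtTwoOffThetaHabitat` | `… → r ≤ 1 → ¬ (r = 0 ∧ GoodSS W 2 ∧ a₂ = 0 ∧ ∃ partner) → BSDp W 2` (= item 20334 VERBATIM = `hOff`) | row 1 minus `19` |

* §1 the two slice `Prop`s;
* §2 glue (excluded middle only): `nonCMAtTwo_iff_thetaHabitat_offThetaHabitat` (row 1 ⟺ habitat ∧
  off-habitat, EXACT — the route's `closes` case split between two named leaves), each ⇐ row 1 ⇐ `WAll`.

References: `Theorems/Rank1ResidualX5TwoDefs.lean` (`NonCMAtTwo`), `WAll/Target.lean` (row 1),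
`WAll/AltClosersResidualCellsAtTwoR0Partner.lean` (closers), route file
`Summits/BirchSwinnertonDyer/BirchSwinnertonDyer/Theses/ThetaPartnerAtTwo.lean` rev 7 (item 20334, `closes`);
`Rank1Residual/Predicates.lean` (`GoodSS`); `GaloisAction.lean` (`geomTorsion` with its `Γ_ℚ`-action);
HOME `bsd-wall-p2/` (habitat census v1.1, KIT-RESULT-TP2-CM-ANCHORS-v1.md); [cite: Miller2011LMS, §1
and Def. 1.1] (the currency `BSD(E,p)`).
-/

noncomputable section

open scoped Classical

open WeierstrassCurve Literature.NumberTheory.EllipticCurves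
  Literature.NumberTheory.EllipticCurves.Rank1Residual Literature.NumberTheory.EllipticCurves.ModularForms
open Summit.BirchSwinnertonDyer.BirchSwinnertonDyer.Rank1Residual (NonCMAtTwo)

set_option autoImplicit false

namespace Summit.BirchSwinnertonDyer

/-! ### §1. Row 1 cut along the theta habitat -/

/-- **Row 1 ON THE THETA HABITAT (OPEN)**: non-CM `E/ℚ` of analytic rank `0`, good supersingular at
`2` with `a₂(E) = 0`, and `2`-congruent — a `Γ_ℚ`-equivariant additive isomorphism
`E[2] ≃ A[2]` of the geometric `2`-torsion — to a CM curve `A/ℚ` (globally minimal model) of analytic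
rank `0`, good supersingular at `2`, `a₂(A) = 0` ⇒ `BSD(E,2)`: the attacked cell of route
`ThetaPartnerAtTwo` (`19` classes of record, N < 5·10⁵), spelled as the hypothesis `hHab` of
`Rank1Residual.WAll.nonCMAtTwo_of_thetaHabitat_of_offThetaHabitat_r0Partner`. [folklore] -/
@[conjecture] def WAllNonCMAtTwoThetaHabitat : Prop :=
  ∀ (W : WeierstrassCurve ℚ) [W.IsElliptic] [W.IsGloballyMinimal], ¬ W.HasCM →
    W.analyticRank = 0 → GoodSS W 2 → W.frobeniusTrace 2 = 0 →
    (∃ (A : WeierstrassCurve ℚ) (_ : A.IsElliptic) (_ : A.IsGloballyMinimal),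
          A.HasCM ∧ A.analyticRank = 0 ∧ GoodSS A 2 ∧ A.frobeniusTrace 2 = 0 ∧
            ∃ e : WeierstrassCurve.geomTorsion W (2 : ℤ) ≃+ WeierstrassCurve.geomTorsion A (2 : ℤ),
              ∀ (σ : Field.absoluteGaloisGroup ℚ) (P : WeierstrassCurve.geomTorsion W (2 : ℤ)),
                e (σ • P) = σ • e P) →
    BSDp W 2

/-- **Row 1 OFF THE THETA HABITAT (OPEN)** — the statement of route item `OffThetaHabitatAtTwo`
(stmt-BirchSwinnertonDyer-20334) VERBATIM: every non-CM `E/ℚ` of analytic rank `≤ 1` that is NOT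
(rank `0` ∧ good supersingular at `2` ∧ `a₂ = 0` ∧ `2`-congruent to a rank-`0` CM good-supersingular
partner with `a₂ = 0`) satisfies `BSD(E,2)` — row 1 minus `19` classes: every non-CM rank-`1` curve at
`2`, every ordinary / multiplicative / additive-at-`2` curve, the `a₂ = ±2` supersingular curves and
the partnerless `a₂ = 0` ones (the territory of `route-BirchSwinnertonDyer-ByReductionTypeAtTwo`; ty-2's
`offThetaHabitatAtTwo_r0Partner_of_reductionTypesAtTwo_of_ssOffHabitat` reads it through the K4 leaves).
[folklore] -/
@[conjecture] def WAllNonCMAtTwoOffThetaHabitat : Prop :=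
  ∀ (W : WeierstrassCurve ℚ) [W.IsElliptic] [W.IsGloballyMinimal], ¬ W.HasCM →
    W.analyticRank ≤ 1 →
    ¬ (W.analyticRank = 0 ∧ GoodSS W 2 ∧ W.frobeniusTrace 2 = 0 ∧
        ∃ (A : WeierstrassCurve ℚ) (_ : A.IsElliptic) (_ : A.IsGloballyMinimal),
          A.HasCM ∧ A.analyticRank = 0 ∧ GoodSS A 2 ∧ A.frobeniusTrace 2 = 0 ∧
            ∃ e : WeierstrassCurve.geomTorsion W (2 : ℤ) ≃+ WeierstrassCurve.geomTorsion A (2 : ℤ),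
              ∀ (σ : Field.absoluteGaloisGroup ℚ) (P : WeierstrassCurve.geomTorsion W (2 : ℤ)),
                e (σ • P) = σ • e P) →
    BSDp W 2

/-! ### §2. Glue (excluded middle only) -/

/-- **Row 1 ⟺ theta habitat ∧ off the theta habitat** (excluded middle on the habitat conjunction;
EXACT) — the case split of the route's deciding theorem `closes`, now between two named leaves (the
same term as ty-2's `nonCMAtTwo_of_thetaHabitat_of_offThetaHabitat_r0Partner` /
`thetaHabitat_offThetaHabitat_r0Partner_of_nonCMAtTwo`, restated on the names so this statement file
stays closer-free). [folklore] -/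
theorem nonCMAtTwo_iff_thetaHabitat_offThetaHabitat :
    NonCMAtTwo ↔ WAllNonCMAtTwoThetaHabitat ∧ WAllNonCMAtTwoOffThetaHabitat :=
  ⟨fun h ↦ ⟨fun W _ _ hcm hr _ _ _ ↦ h W hcm (by omega), fun W _ _ hcm hr _ ↦ h W hcm hr⟩,
    fun ⟨hHab, hOff⟩ W _ _ hcm hr ↦ by
      by_cases hH : (W.analyticRank = 0 ∧ GoodSS W 2 ∧ W.frobeniusTrace 2 = 0 ∧
          ∃ (A : WeierstrassCurve ℚ) (_ : A.IsElliptic) (_ : A.IsGloballyMinimal),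
            A.HasCM ∧ A.analyticRank = 0 ∧ GoodSS A 2 ∧ A.frobeniusTrace 2 = 0 ∧
              ∃ e : WeierstrassCurve.geomTorsion W (2 : ℤ) ≃+ WeierstrassCurve.geomTorsion A (2 : ℤ),
                ∀ (σ : Field.absoluteGaloisGroup ℚ) (P : WeierstrassCurve.geomTorsion W (2 : ℤ)),
                  e (σ • P) = σ • e P)
      · exact hHab W hcm hH.1 hH.2.1 hH.2.2.1 hH.2.2.2
      · exact hOff W hcm hr hH⟩

/-- Row 1 from its two slices. [folklore] -/
theorem nonCMAtTwo_of_thetaHabitat_of_offThetaHabitat (hHab : WAllNonCMAtTwoThetaHabitat)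
    (hOff : WAllNonCMAtTwoOffThetaHabitat) : NonCMAtTwo :=
  nonCMAtTwo_iff_thetaHabitat_offThetaHabitat.2 ⟨hHab, hOff⟩

/-- Conversely row 1 restricts to both slices. [folklore] -/
theorem thetaSlices_of_nonCMAtTwo (h : NonCMAtTwo) :
    WAllNonCMAtTwoThetaHabitat ∧ WAllNonCMAtTwoOffThetaHabitat :=
  nonCMAtTwo_iff_thetaHabitat_offThetaHabitat.1 h

/-- … and both follow from `WAll` (row 1 is the `p = 2`, non-CM instance of it). [folklore] -/
theorem thetaSlices_of_wAll (h : WAll) :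
    WAllNonCMAtTwoThetaHabitat ∧ WAllNonCMAtTwoOffThetaHabitat :=
  thetaSlices_of_nonCMAtTwo fun W _ _ _ hr ↦ h W 2 hr

end Summit.BirchSwinnertonDyer

end
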